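import Mathlib
import Summits.Ventures.PercRepro2.UniversalBundleStepSP
import Summits.Ventures.PercRepro2.UniversalB33

/-! # Towers `X ∧ B_K`, `K ≥ 3`, over small networks `X` with a computed package
(seat mine-b, cell pub-perc-repro2; MINE-B.md §25.2, §25.12)

For a fixed series–parallel network `X` of free edges, the package `(f, θ, g)` of
`SP.universal_ser_bundle` — an (UH*) assignment, a red-up map on `{r ≥ 1, b ≥ 2}` and the level-1
datum (L1) on the blue-1 targets of the blue-1 sources — is a finite object, found by matching and
verified here by `decide +kernel` (tables; no `native_decide`).  `SP.universal_ser_bundle` then gives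
(UH*) on `X ∧ B_K` for EVERY `K ≥ 3` at once: infinite families of networks of flow `≥ 3` that are not
series of bundles, beyond the `≤ 8`-edge kernel census of UniversalSmall8*.lean.  Networks:
* (((e ∧ e) ∗ (e ∧ e)) ∗ (e ∧ e)): 6 edges, 64 configurations, 19 sources / 27 slots, |Q| = 3, |D¹| = 0
* (((e ∗ e) ∗ e) ∗ (e ∧ (e ∗ e))): 6 edges, 64 configurations, 5 sources / 18 slots, |Q| = 36, |D¹| = 0
* ((e ∗ (e ∧ e)) ∗ ((e ∧ e) ∧ e)): 6 edges, 64 configurations, 21 sources / 31 slots, |Q| = 3, |D¹| = 0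
The configuration order of an SP term is decidable by `SP.confDecLE` (UniversalB33.lean). -/

namespace Summit.Ventures.PercRepro2.V2Closure

open Summit.Ventures.PercRepro2.UHClosure

/-- the network `P₂ ∗ P₂ ∗ P₂` (three two-edge paths in parallel, the theta graph; flow 3) -/
abbrev SP.p2p2p2 : SP := (SP.par (SP.par (SP.ser SP.free SP.free) (SP.ser SP.free SP.free)) (SP.ser SP.free SP.free))

/-- the (UH*) table of `p2p2p2`: (source, slot, target) -/
def p2p2p2FT : List (SP.p2p2p2.Conf × ℕ × SP.p2p2p2.Conf) := [
  ((((true, true), (true, false)), (true, false)), 0, (((true, false), (true, false)), (false, false))),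
  ((((true, true), (false, true)), (true, false)), 0, (((true, false), (false, true)), (false, false))),
  ((((true, false), (true, true)), (true, false)), 0, (((true, false), (false, false)), (true, false))),
  ((((false, true), (true, true)), (true, false)), 0, (((false, true), (true, false)), (false, false))),
  ((((true, true), (true, true)), (true, false)), 0, (((true, false), (true, true)), (false, false))),
  ((((true, true), (true, true)), (true, false)), 1, (((true, true), (true, false)), (false, false))),
  ((((true, true), (true, false)), (false, true)), 0, (((true, false), (false, false)), (false, true))),
  ((((true, true), (false, true)), (false, true)), 0, (((false, true), (false, true)), (false, false))),
  ((((true, false), (true, true)), (false, true)), 0, (((false, false), (true, false)), (false, true))),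
  ((((false, true), (true, true)), (false, true)), 0, (((false, true), (false, false)), (false, true))),
  ((((true, true), (true, true)), (false, true)), 0, (((false, true), (true, true)), (false, false))),
  ((((true, true), (true, true)), (false, true)), 1, (((true, true), (false, true)), (false, false))),
  ((((true, false), (true, false)), (true, true)), 0, (((false, false), (true, false)), (true, false))),
  ((((false, true), (true, false)), (true, true)), 0, (((false, true), (false, false)), (true, false))),
  ((((true, true), (true, false)), (true, true)), 0, (((true, true), (false, false)), (true, false))),
  ((((true, true), (true, false)), (true, true)), 1, (((true, true), (false, false)), (false, true))),
  ((((true, false), (false, true)), (true, true)), 0, (((false, false), (false, true)), (true, false))),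
  ((((false, true), (false, true)), (true, true)), 0, (((false, false), (false, true)), (false, true))),
  ((((true, true), (false, true)), (true, true)), 0, (((true, false), (false, false)), (true, true))),
  ((((true, true), (false, true)), (true, true)), 1, (((false, true), (false, false)), (true, true))),
  ((((true, false), (true, true)), (true, true)), 0, (((false, false), (true, true)), (true, false))),
  ((((true, false), (true, true)), (true, true)), 1, (((false, false), (true, true)), (false, true))),
  ((((false, true), (true, true)), (true, true)), 0, (((false, false), (true, false)), (true, true))),
  ((((false, true), (true, true)), (true, true)), 1, (((false, false), (false, true)), (true, true))),
  ((((true, true), (true, true)), (true, true)), 0, (((true, true), (true, true)), (false, false))),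
  ((((true, true), (true, true)), (true, true)), 1, (((true, true), (false, false)), (true, true))),
  ((((true, true), (true, true)), (true, true)), 2, (((false, false), (true, true)), (true, true)))]

/-- the red-up table of `p2p2p2`: (x, θ x) on {r ≥ 1, b ≥ 2} -/
def p2p2p2TT : List (SP.p2p2p2.Conf × SP.p2p2p2.Conf) := [
  ((((true, true), (true, true)), (false, false)), (((true, true), (false, false)), (false, false))),
  ((((true, true), (false, false)), (true, true)), (((false, false), (false, false)), (true, true))),
  ((((false, false), (true, true)), (true, true)), (((false, false), (true, true)), (false, false)))]

/-- the (L1) table of `p2p2p2`: (x, g x) on the blue-1 targets of the blue-1 sources -/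
def p2p2p2GT : List (SP.p2p2p2.Conf × SP.p2p2p2.Conf) := [
]

/-- the (UH*) assignment of `p2p2p2` (table lookup) -/
def p2p2p2Assign (p : SlotL (USrc SP.p2p2p2.rLab SP.p2p2p2.bLab) SP.p2p2p2.bLab) : SP.p2p2p2.Conf :=
  match p2p2p2FT.find? (fun e => e.1 = p.1.1.1 ∧ e.2.1 = p.1.2.val) with
  | some e => e.2.2
  | none => p.1.1.1

/-- the red-up map of `p2p2p2` (table lookup) -/
def p2p2p2Theta (x : SP.p2p2p2.Conf) : SP.p2p2p2.Conf :=
  match p2p2p2TT.find? (fun e => e.1 = x) with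
  | some e => e.2
  | none => x

/-- the (L1) datum of `p2p2p2` (table lookup) -/
def p2p2p2Gmap (x : SP.p2p2p2.Conf) : SP.p2p2p2.Conf :=
  match p2p2p2GT.find? (fun e => e.1 = x) with
  | some e => e.2
  | none => x

/-- membership in the (L1) domain of `p2p2p2` is decidable -/
instance : DecidablePred (InD1 SP.p2p2p2.rLab SP.p2p2p2.bLab p2p2p2Assign) := fun _ => by
  unfold InD1; infer_instance

set_option maxRecDepth 40000 in
/-- **(UH*) on `p2p2p2 ∧ B_K` for every `K ≥ 3`** — the package of `p2p2p2` by kernel computation, the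
series step by `SP.universal_ser_bundle`. -/
theorem SP.universal_p2p2p2_bundle (K : ℕ) (hK : 3 ≤ K) :
    Universal (SP.ser SP.p2p2p2 (SP.bundle K)).rLab (SP.ser SP.p2p2p2 (SP.bundle K)).bLab :=
  SP.universal_ser_bundle SP.p2p2p2 K hK p2p2p2Assign (by decide +kernel) (by decide +kernel)
    p2p2p2Theta (by decide +kernel) (by decide +kernel) p2p2p2Gmap (by decide +kernel) (by decide +kernel)
    (by decide +kernel) (by decide +kernel)

/-- the network `B₃ ∗ (e ∧ B₂)` (flow 4) -/
abbrev SP.b3eb2 : SP := (SP.par (SP.par (SP.par SP.free SP.free) SP.free) (SP.ser SP.free (SP.par SP.free SP.free)))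

/-- the (UH*) table of `b3eb2`: (source, slot, target) -/
def b3eb2FT : List (SP.b3eb2.Conf × ℕ × SP.b3eb2.Conf) := [
  ((((true, true), true), (true, (false, false))), 0, (((false, true), true), (true, (false, false)))),
  ((((true, true), true), (true, (false, false))), 1, (((true, true), false), (true, (false, false)))),
  ((((true, true), true), (true, (false, false))), 2, (((true, false), true), (true, (false, false)))),
  ((((true, true), true), (true, (true, false))), 0, (((true, true), true), (false, (true, false)))),
  ((((true, true), true), (true, (true, false))), 1, (((true, true), false), (true, (true, false)))),
  ((((true, true), true), (true, (true, false))), 2, (((true, false), true), (true, (true, false)))),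
  ((((true, true), true), (true, (true, false))), 3, (((false, true), true), (true, (true, false)))),
  ((((true, true), true), (true, (false, true))), 0, (((true, true), true), (false, (false, true)))),
  ((((true, true), true), (true, (false, true))), 1, (((true, true), false), (true, (false, true)))),
  ((((true, true), true), (true, (false, true))), 2, (((true, false), true), (true, (false, true)))),
  ((((true, true), true), (true, (false, true))), 3, (((false, true), true), (true, (false, true)))),
  ((((true, true), true), (false, (true, true))), 0, (((true, true), false), (false, (true, true)))),
  ((((true, true), true), (false, (true, true))), 1, (((true, false), true), (false, (true, true)))),
  ((((true, true), true), (false, (true, true))), 2, (((false, true), true), (false, (true, true)))),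
  ((((true, true), true), (true, (true, true))), 0, (((true, true), false), (true, (true, true)))),
  ((((true, true), true), (true, (true, true))), 1, (((true, false), true), (true, (true, true)))),
  ((((true, true), true), (true, (true, true))), 2, (((false, true), true), (true, (true, true)))),
  ((((true, true), true), (true, (true, true))), 3, (((true, true), true), (false, (false, false))))]

/-- the red-up table of `b3eb2`: (x, θ x) on {r ≥ 1, b ≥ 2} -/
def b3eb2TT : List (SP.b3eb2.Conf × SP.b3eb2.Conf) := [
  ((((true, true), false), (false, (false, false))), (((true, false), false), (false, (false, false)))),
  ((((true, false), true), (false, (false, false))), (((false, false), true), (false, (false, false)))),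
  ((((false, true), true), (false, (false, false))), (((false, true), false), (false, (false, false)))),
  ((((true, true), true), (false, (false, false))), (((true, false), true), (false, (false, false)))),
  ((((true, true), false), (true, (false, false))), (((true, false), false), (true, (false, false)))),
  ((((true, false), true), (true, (false, false))), (((false, false), true), (true, (false, false)))),
  ((((false, true), true), (true, (false, false))), (((false, true), false), (true, (false, false)))),
  ((((true, true), false), (false, (true, false))), (((true, true), false), (false, (true, false)))),
  ((((true, false), true), (false, (true, false))), (((true, false), false), (false, (true, false)))),
  ((((false, true), true), (false, (true, false))), (((false, false), true), (false, (true, false)))),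
  ((((true, true), true), (false, (true, false))), (((true, false), true), (false, (true, false)))),
  ((((true, false), false), (true, (true, false))), (((false, false), false), (true, (true, false)))),
  ((((false, true), false), (true, (true, false))), (((false, true), false), (false, (true, false)))),
  ((((true, true), false), (true, (true, false))), (((false, true), false), (true, (true, false)))),
  ((((false, false), true), (true, (true, false))), (((false, false), true), (true, (true, false)))),
  ((((true, false), true), (true, (true, false))), (((true, false), false), (true, (true, false)))),
  ((((false, true), true), (true, (true, false))), (((false, true), true), (false, (true, false)))),
  ((((true, true), false), (false, (false, true))), (((true, true), false), (false, (false, true)))),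
  ((((true, false), true), (false, (false, true))), (((true, false), false), (false, (false, true)))),
  ((((false, true), true), (false, (false, true))), (((false, false), true), (false, (false, true)))),
  ((((true, true), true), (false, (false, true))), (((true, false), true), (false, (false, true)))),
  ((((true, false), false), (true, (false, true))), (((false, false), false), (true, (false, true)))),
  ((((false, true), false), (true, (false, true))), (((false, true), false), (false, (false, true)))),
  ((((true, true), false), (true, (false, true))), (((false, true), false), (true, (false, true)))),
  ((((false, false), true), (true, (false, true))), (((false, false), true), (true, (false, true)))),
  ((((true, false), true), (true, (false, true))), (((true, false), false), (true, (false, true)))),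
  ((((false, true), true), (true, (false, true))), (((false, true), true), (false, (false, true)))),
  ((((true, true), false), (false, (true, true))), (((true, true), false), (false, (false, false)))),
  ((((true, false), true), (false, (true, true))), (((false, false), true), (false, (true, true)))),
  ((((false, true), true), (false, (true, true))), (((false, true), false), (false, (true, true)))),
  ((((true, false), false), (true, (true, true))), (((true, false), false), (false, (true, true)))),
  ((((false, true), false), (true, (true, true))), (((false, false), false), (true, (true, true)))),
  ((((true, true), false), (true, (true, true))), (((false, true), false), (true, (true, true)))),
  ((((false, false), true), (true, (true, true))), (((false, false), true), (true, (true, true)))),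
  ((((true, false), true), (true, (true, true))), (((true, false), false), (true, (true, true)))),
  ((((false, true), true), (true, (true, true))), (((false, true), true), (false, (false, false))))]

/-- the (L1) table of `b3eb2`: (x, g x) on the blue-1 targets of the blue-1 sources -/
def b3eb2GT : List (SP.b3eb2.Conf × SP.b3eb2.Conf) := [
]

/-- the (UH*) assignment of `b3eb2` (table lookup) -/
def b3eb2Assign (p : SlotL (USrc SP.b3eb2.rLab SP.b3eb2.bLab) SP.b3eb2.bLab) : SP.b3eb2.Conf :=
  match b3eb2FT.find? (fun e => e.1 = p.1.1.1 ∧ e.2.1 = p.1.2.val) with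
  | some e => e.2.2
  | none => p.1.1.1

/-- the red-up map of `b3eb2` (table lookup) -/
def b3eb2Theta (x : SP.b3eb2.Conf) : SP.b3eb2.Conf :=
  match b3eb2TT.find? (fun e => e.1 = x) with
  | some e => e.2
  | none => x

/-- the (L1) datum of `b3eb2` (table lookup) -/
def b3eb2Gmap (x : SP.b3eb2.Conf) : SP.b3eb2.Conf :=
  match b3eb2GT.find? (fun e => e.1 = x) with
  | some e => e.2
  | none => x

/-- membership in the (L1) domain of `b3eb2` is decidable -/
instance : DecidablePred (InD1 SP.b3eb2.rLab SP.b3eb2.bLab b3eb2Assign) := fun _ => by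
  unfold InD1; infer_instance

set_option maxRecDepth 40000 in
/-- **(UH*) on `b3eb2 ∧ B_K` for every `K ≥ 3`** — the package of `b3eb2` by kernel computation, the
series step by `SP.universal_ser_bundle`. -/
theorem SP.universal_b3eb2_bundle (K : ℕ) (hK : 3 ≤ K) :
    Universal (SP.ser SP.b3eb2 (SP.bundle K)).rLab (SP.ser SP.b3eb2 (SP.bundle K)).bLab :=
  SP.universal_ser_bundle SP.b3eb2 K hK b3eb2Assign (by decide +kernel) (by decide +kernel)
    b3eb2Theta (by decide +kernel) (by decide +kernel) b3eb2Gmap (by decide +kernel) (by decide +kernel)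
    (by decide +kernel) (by decide +kernel)

/-- the network `e ∗ P₂ ∗ P₃` (flow 3) -/
abbrev SP.ep2p3 : SP := (SP.par (SP.par SP.free (SP.ser SP.free SP.free)) (SP.ser (SP.ser SP.free SP.free) SP.free))

/-- the (UH*) table of `ep2p3`: (source, slot, target) -/
def ep2p3FT : List (SP.ep2p3.Conf × ℕ × SP.ep2p3.Conf) := [
  (((true, (true, false)), ((true, false), false)), 0, ((false, (true, false)), ((true, false), false))),
  (((true, (false, true)), ((true, false), false)), 0, ((false, (false, true)), ((true, false), false))),
  (((true, (true, true)), ((true, false), false)), 0, ((true, (true, false)), ((false, false), false))),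
  (((true, (true, true)), ((true, false), false)), 1, ((true, (false, false)), ((true, false), false))),
  (((true, (true, false)), ((false, true), false)), 0, ((false, (true, false)), ((false, true), false))),
  (((true, (false, true)), ((false, true), false)), 0, ((false, (false, true)), ((false, true), false))),
  (((true, (true, true)), ((false, true), false)), 0, ((true, (false, true)), ((false, false), false))),
  (((true, (true, true)), ((false, true), false)), 1, ((true, (false, false)), ((false, true), false))),
  (((true, (true, false)), ((true, true), false)), 0, ((false, (true, false)), ((true, true), false))),
  (((true, (false, true)), ((true, true), false)), 0, ((false, (false, true)), ((true, true), false))),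
  (((true, (true, true)), ((true, true), false)), 0, ((false, (true, true)), ((true, true), false))),
  (((true, (true, true)), ((true, true), false)), 1, ((false, (true, true)), ((true, false), false))),
  (((true, (true, false)), ((false, false), true)), 0, ((false, (true, false)), ((false, false), true))),
  (((true, (false, true)), ((false, false), true)), 0, ((false, (false, true)), ((false, false), true))),
  (((true, (true, true)), ((false, false), true)), 0, ((true, (false, false)), ((false, false), true))),
  (((true, (true, true)), ((false, false), true)), 1, ((false, (true, true)), ((false, false), true))),
  (((true, (true, false)), ((true, false), true)), 0, ((false, (true, false)), ((true, false), true))),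
  (((true, (false, true)), ((true, false), true)), 0, ((false, (false, true)), ((true, false), true))),
  (((true, (true, true)), ((true, false), true)), 0, ((true, (false, false)), ((true, false), true))),
  (((true, (true, true)), ((true, false), true)), 1, ((false, (true, true)), ((true, false), true))),
  (((true, (true, false)), ((false, true), true)), 0, ((false, (true, false)), ((false, true), true))),
  (((true, (false, true)), ((false, true), true)), 0, ((false, (false, true)), ((false, true), true))),
  (((true, (true, true)), ((false, true), true)), 0, ((false, (true, true)), ((false, true), true))),
  (((true, (true, true)), ((false, true), true)), 1, ((false, (true, true)), ((false, true), false))),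
  (((true, (true, false)), ((true, true), true)), 0, ((true, (false, false)), ((false, true), true))),
  (((true, (true, false)), ((true, true), true)), 1, ((false, (true, false)), ((true, true), true))),
  (((true, (false, true)), ((true, true), true)), 0, ((false, (false, true)), ((true, true), true))),
  (((true, (false, true)), ((true, true), true)), 1, ((true, (false, false)), ((true, true), false))),
  (((true, (true, true)), ((true, true), true)), 0, ((false, (true, true)), ((true, true), true))),
  (((true, (true, true)), ((true, true), true)), 1, ((true, (true, true)), ((false, false), false))),
  (((true, (true, true)), ((true, true), true)), 2, ((true, (false, false)), ((true, true), true)))]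

/-- the red-up table of `ep2p3`: (x, θ x) on {r ≥ 1, b ≥ 2} -/
def ep2p3TT : List (SP.ep2p3.Conf × SP.ep2p3.Conf) := [
  (((true, (true, true)), ((false, false), false)), ((true, (false, false)), ((false, false), false))),
  (((true, (false, false)), ((true, true), true)), ((false, (false, false)), ((true, true), true))),
  (((false, (true, true)), ((true, true), true)), ((false, (true, true)), ((false, false), false)))]

/-- the (L1) table of `ep2p3`: (x, g x) on the blue-1 targets of the blue-1 sources -/
def ep2p3GT : List (SP.ep2p3.Conf × SP.ep2p3.Conf) := [
]

/-- the (UH*) assignment of `ep2p3` (table lookup) -/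
def ep2p3Assign (p : SlotL (USrc SP.ep2p3.rLab SP.ep2p3.bLab) SP.ep2p3.bLab) : SP.ep2p3.Conf :=
  match ep2p3FT.find? (fun e => e.1 = p.1.1.1 ∧ e.2.1 = p.1.2.val) with
  | some e => e.2.2
  | none => p.1.1.1

/-- the red-up map of `ep2p3` (table lookup) -/
def ep2p3Theta (x : SP.ep2p3.Conf) : SP.ep2p3.Conf :=
  match ep2p3TT.find? (fun e => e.1 = x) with
  | some e => e.2
  | none => x

/-- the (L1) datum of `ep2p3` (table lookup) -/
def ep2p3Gmap (x : SP.ep2p3.Conf) : SP.ep2p3.Conf :=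
  match ep2p3GT.find? (fun e => e.1 = x) with
  | some e => e.2
  | none => x

/-- membership in the (L1) domain of `ep2p3` is decidable -/
instance : DecidablePred (InD1 SP.ep2p3.rLab SP.ep2p3.bLab ep2p3Assign) := fun _ => by
  unfold InD1; infer_instance

set_option maxRecDepth 40000 in
/-- **(UH*) on `ep2p3 ∧ B_K` for every `K ≥ 3`** — the package of `ep2p3` by kernel computation, the
series step by `SP.universal_ser_bundle`. -/
theorem SP.universal_ep2p3_bundle (K : ℕ) (hK : 3 ≤ K) :
    Universal (SP.ser SP.ep2p3 (SP.bundle K)).rLab (SP.ser SP.ep2p3 (SP.bundle K)).bLab :=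
  SP.universal_ser_bundle SP.ep2p3 K hK ep2p3Assign (by decide +kernel) (by decide +kernel)
    ep2p3Theta (by decide +kernel) (by decide +kernel) ep2p3Gmap (by decide +kernel) (by decide +kernel)
    (by decide +kernel) (by decide +kernel)

end Summit.Ventures.PercRepro2.V2Closure

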